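import Literature.NumberTheory.Automorphic.UnitaryGroupCotangentSpectralProjection
import Literature.NumberTheory.Automorphic.UnitaryGroupCotangentSpectralProjectionConj
import Literature.Geometry.ComplexHyperbolic.UnitBallU21Borel
import Summits.HodgeConjecture.HodgeConjecture.Theorems.P2H413OfSockets
import Summits.HodgeConjecture.HodgeConjecture.Theorems.P2StubGHolGermOfWeak        -- ★ p797242 (F0P2-p01 (g2)): closes (G) BY NAME [v1.2]
import Summits.HodgeConjecture.HodgeConjecture.Theorems.F0P2dStubT                  -- ★ p797536 (F0P2-p02 (g2)): closes (T) BY NAME [v1.2]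
import Summits.HodgeConjecture.HodgeConjecture.Theorems.F0P2dStubHProjectedL2Data  -- ★ p797557 (A-p06 (g18)): closes (H) BY NAME [v1.2]
import Literature.NumberTheory.Automorphic.UnitaryGroupHolCotFormsReproducing     -- ★ p797711 (p03 (g2)): closes (K) BY NAME [v1.3]
import Summits.HodgeConjecture.HodgeConjecture.Theorems.F0P2dStubR                  -- ★ p798945 (F0P2-p04 (g2)): closes (R) BY NAME [v1.4]
import Summits.HodgeConjecture.HodgeConjecture.Theorems.F0P2dStubSCotFormL2Data   -- ★ p798875 (A-p18 (g16)): closes (S) BY NAME [v1.5]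
import HarnessLib

-- v1.2 registrar pass (A-plan1 (g18); director s355 cure): `[cite: …]` tags inside socket-`def` docstrings are rewritten as prose
-- `(print: …)`; theorem tags kept.

/-!
# Crux `H413` — DESK SUB-LINE **F0-P2SpectralProjectionD**: the (D) socket `CotangentForms.holCotFormSpectralProjection`
# («the spectral projection `pr_P` of a holomorphic cotangent form is a holomorphic cotangent form», TP⁺) CUT INTO SIX REGISTERED
# STUBS along the HOLOMORPHIC-REPRODUCTION ROAD — reproducing kernel on `U(2,1)` (K) · `L²` shadow of the form (S) · Hilbert transport
# through `pr_P` (H) · regularity of REPRODUCED classes (R) · pointwise Cauchy–Riemann from the weak one (G) · pointwise invariances from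
# the a.e. ones (T) — with a kernel-checked head
# `holCotFormSpectralProjection_of_stubs : K → S → H → R → G → T → CotangentForms.holCotFormSpectralProjection` BY NAME, (D̄) by ★ p794879.

EDITIONS: v1.1 (F0P2-plan (g2), 2026-08-31T00:03Z; 6 `sorry`) · **v1.2 (registrar fold-cut, A-plan1 (g18), 2026-08-31T00:2xZ): (G), (T), (H)
CLOSED BY NAME over ★ p797242 ∕ ★ p797536 ∕ ★ p797557 — every statement byte-identical to v1.1; open stubs = {(K), (S), (R)}** · **v1.3 (registrar fold-cut, A-plan1 (g18), 2026-08-31T00:3xZ): (K) CLOSED BY NAME over ★ p797711 (p03 (g2)) —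
statement byte-identical; open stubs = {(S), (R)}.** · **v1.4 (registrar fold-cut, A-plan1 (g18), 2026-08-31T00:5xZ): (R) CLOSED BY NAME over
★ p798945 `Theorems/F0P2dStubR` (F0P2-p04 (g2); engine ★ p798202 `Theorems/F0P2dStubREngine`) — statement byte-identical; open stubs = {(S)}.** · **v1.5 (registrar fold-cut, A-plan1 (g18),
2026-08-31T01:0xZ): (S) CLOSED BY NAME over ★ p798875 `Theorems/F0P2dStubSCotFormL2Data` (A-p18 (g16); + ★ p798200 `F0P2dStubSOrbitMap`) — statement
byte-identical; OPEN STUBS = ∅ — THE LINE IS SORRY-FREE; the (D) socket itself is ★ p799091 `Theorems/F0P2dSocketD :: holCotFormSpectralProjection_holds`.**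

HC_CM is proved only modulo the printed citations until rung 0 closes.  Cell `hodgecm-mathlib`, floor 0, programme P2 (theta);
unit `hodgecm-mathlib-F0P2-plan` (g2), 2026-08-30/31; regularity census `F0/P2/CENSUS-R.F0P2p01g2.md` (F0P2-p01 (g2), road (h)) and
`F0/P2/MEMO-D-in-tree.F0P2p01g2.md`.  Parent line of record: `Lines/P2ThetaDictionaryExists.lean` v4b (sorries 4 = sockets (C)
`Rogawski1990.cohFinComponent_isTheta`, (C′) `Def411WeilCarriers.rhoAtLine_lineClassTransport`, (D) `CotangentForms.holCotFormSpectralProjection`,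
U4 `StubU4SignRule`); cut `Lines/F0_P2CohSpectrumL2.lean` v1.4 (sockets C, C′, D).  This sub-line decomposes the (D) socket only; nothing here
is asserted beyond the six `stub_*` (each `sorry`, each a closed named `Prop`), and the parent's `stub_D_holCotFormSpectralProjection` folds by
the ONE token `F0P2SpectralProjectionD.holCotFormSpectralProjection_of_stubs stub_K_reproducingKernel stub_S_cotFormL2Data
stub_H_projectedL2Data stub_R_regularOfReproduced stub_G_holGermOfWeak stub_T_memHolCotFormsOfAe` once the six close (closers land
`Theorems/F0P2dStub<Name>.lean :: stub<Name>_holds` with the def body VERBATIM, the Lines-local bundles `G3`, `orbitP`, `probeP`, `kernelOp`,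
`IsWeaklyHol`, `Realises`, `IsRegularKernel`, `IsReproducedAlong`, `IsL2CotPair` unfolded — s347; nothing imports this module — s380b).

## The idea (CENSUS-R road (h): NO Sobolev, NO `(𝔤,K)`-theory, NO `𝒵(𝔤)`, NO irreducibility of `P`)

Write `u_j := [Φ·j] ∈ L²` for the two coordinates of `Φ ∈ holCotForms` and `w_j := pr_P u_j`.  Everything the conclusion asks of a
representative `Ψ` of `(w_0, w_1)` — left-`U(H)(L⁺)`-invariance, right cotangent `K_∞`-type `τ = weightOf x₀` along `cmArchSection`, right
`K_c`- and `K_f`-invariance, HOLOMORPHIC GERMS — has an `L²` SHADOW that (S) reads off `Φ` and (H) transports through `pr_P`, because `pr_P` is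
continuous linear and commutes with the right regular representation `R` (★ `DiscreteAutomorphicRep.starProjection_rightRegular`): the
invariances and the type relation verbatim, holomorphy as «the `𝔭`-orbit map `b ↦ R(cmArchSection (exp X_b)) w_j : ℂ² → L²` has `ℂ`-LINEAR
differential at `0`» (weak Cauchy–Riemann).  The one analytic input is the MEAN-VALUE PROPERTY (K): holomorphic functions on the ball are
reproduced by compactly supported radial bumps, so — transported by the cotangent automorphy factor — every function on a group of right
`K_∞`-type `τ` with holomorphic germs along `U(2,1)` satisfies `∫_{U(2,1)} A(u) Φ(y · u) dν(u) = Φ(y)` for ONE explicit smooth compactly supported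
MATRIX kernel `A`; in `L²`, `T_A u = u`, and since `T_A` commutes with `pr_P`, ALSO `T_A w = w`: the projected classes are CONVOLVED classes.
(R) then gives them continuous representatives, `C¹` along the `𝔭`-probes with probe derivatives representing the `L²`-derivatives (Fubini +
differentiation under the integral + «a null union of open orbits is empty»); (G) upgrades weak Cauchy–Riemann to `IsHolGerm` pointwise and
(T) the a.e. invariances to pointwise ones (continuity + `μ` charges opens, ★ `IsAutomorphicMeasure`), i.e. `Ψ ∈ holCotForms`, and
`[Ψ·j] = w_j` closes (D).  (D̄) is ★ `CotangentForms.antiholCotFormSpectralProjection_of_hol` (p794879).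

## Registered stubs (6; `theorem stub_<name> : <closed Prop> := by sorry`; sizes in the docstrings)

* `stub_K_reproducingKernel : StubKReproducingKernel` — (K) HARDEST ∕ load-bearing, M–L: the matrix reproducing kernel (mean value on `𝔹²`).
* `stub_S_cotFormL2Data : StubSCotFormL2Data` — (S) M: `[Φ]` carries `IsL2CotPair` (reproduction in `L²`, invariances, type, weak CR).
* `stub_H_projectedL2Data : StubHProjectedL2Data` — (H) S–M: `IsL2CotPair u → IsL2CotPair (pr_P ∘ u)`.
* `stub_R_regularOfReproduced : StubRRegularOfReproduced` — (R) M–L: reproduced `K_c K_f`-invariant classes have `Realises`-representatives.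
* `stub_G_holGermOfWeak : StubGHolGermOfWeak` — (G) M: `Realises` + `IsWeaklyHol` ⇒ `IsHolGerm cmArchSection Ψ`.
* `stub_T_memHolCotFormsOfAe : StubTMemHolCotFormsOfAe` — (T) M−: `Realises` + `L²` relations + `IsHolGerm` ⇒ `Ψ ∈ holCotForms`.

Heads: `holCotFormSpectralProjection_of` ∕ `_of_stubs` (sorry-free; `ν := Measure.haar`), `antiholCotFormSpectralProjection_of_stubs` (★ p794879),
`socketD_of_stubs` (both), and `H413_proof` = the crux BY NAME from the six stubs + sockets (C), (C′), U4 + rows `hJ3a`, `hocc` (★ `P2H413OfSockets.H413_of_sockets`).  `lean check`: rc 0, sorries EXACTLY 6 (the six `stub_*`).  HC_CM is proved only modulo the printed citations until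
rung 0 closes.

## References
* [BorelJacquet1979] A. Borel, H. Jacquet, Corvallis PSPM 33.1 (1979), §4.1–4.2, §4.6 (`pr_P` is `G(𝔸)`-equivariant).
* [Borel1997] A. Borel, *Automorphic forms on SL₂(ℝ)*, Cambridge Tracts 130 (1997), Thm. 2.13–2.14 and §8.4 (regularity by convolution), §5.14.
* [HarishChandra1966] Harish-Chandra, *Discrete series for semisimple Lie groups II*, Acta Math. 116 (1966), §8 Thm. 1 (`φ = φ ∗ α`).
* [HarishChandra1968] Harish-Chandra, *Automorphic forms on semisimple Lie groups*, LNM 62 (1968), §I.2.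
* [Helgason2000] S. Helgason, *Groups and Geometric Analysis* (2000), Ch. I §1, Thm. 1.9 (invariant measure on `G/K`).
* [BorelWallach2000] A. Borel, N. Wallach, 2nd ed. (2000), VII 2.10.
* [DeitmarEchterhoff2014] A. Deitmar, S. Echterhoff, *Principles of Harmonic Analysis*, 2nd ed. (2014), Thm. 7.3.2.
-/

set_option autoImplicit false
set_option linter.dupNamespace false

noncomputable section

open scoped Matrix ComplexOrder ContDiff
open NumberField MulAction MeasureTheory
open Literature.NumberTheory.Automorphic Literature.NumberTheory.Automorphic.UnitaryGroup
open Literature.NumberTheory.Automorphic.UnitaryGroup.CotangentForms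
open Literature.AlgebraicGeometry.ShimuraVarieties
open Literature.Geometry.ComplexHyperbolic.BallModel (U21 x₀)

namespace Summit.HodgeConjecture.HodgeConjecture.Cruxes.H413.F0P2SpectralProjectionD

/-! ## §0 Lines-local bundles (closers UNFOLD these verbatim; nothing here is a new mathematical object) -/

section Generic

variable {K : Type} [Field K] [NumberField K] (𝒢 : AdelicGroupData.{0} K)
  (μ : Measure 𝒢.automorphicQuotient) [SMulInvariantMeasure 𝒢.Adelic 𝒢.automorphicQuotient μ]
  (ιinf : U21 →* 𝒢.Adelic)

/-- **The `𝔭`-orbit map of an `L²` class** along an archimedean section `ιinf : U(2,1) →* G(𝔸)`: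
`b ↦ R(ιinf (exp X_b)) v`, `b ∈ ℂ² ≅ 𝔭` (★ `BallForms.expP`, ★ `AdelicGroupData.rightRegular`). (print: BorelWallach2000, XIII 1.2) -/
def orbitP (v : 𝒢.L2 μ) : (Fin 2 → ℂ) → 𝒢.L2 μ :=
  fun b => 𝒢.rightRegular μ (ιinf (BallForms.expP b)) v

/-- **The `𝔭`-probe of a scalar function at a base point `y`**: `b ↦ Ψ (y · ιinf (exp X_b))` (the scalar version of ★
`CotangentForms.germAt`). (print: Borel1997, §5.14) -/
def probeP (Ψ : 𝒢.Adelic → ℂ) (y : 𝒢.Adelic) : (Fin 2 → ℂ) → ℂ :=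
  fun b => Ψ (y * ιinf (BallForms.expP b))

/-- **The kernel operator of a matrix kernel on `U(2,1)` acting on PAIRS of `L²` classes**:
`(T_A v)_j := Σ_i ∫_{U(2,1)} A(u)_{ji} • R(ιinf u) v_i dν(u)` (Bochner integral in `L²`; `ν` a Haar measure on `U(2,1)`,
★ `UnitBallU21Borel`).  The `L²` form of right convolution by the kernel `A`. (print: Borel1997, §2.13–2.14) (print: HarishChandra1966, §8) -/
def kernelOp (ν : Measure U21) (A : U21 → Matrix (Fin 2) (Fin 2) ℂ) (v : Fin 2 → 𝒢.L2 μ) (j : Fin 2) : 𝒢.L2 μ :=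
  ∑ i : Fin 2, ∫ u, A u j i • 𝒢.rightRegular μ (ιinf u) (v i) ∂ν

/-- **Weak (`L²`) Cauchy–Riemann**: the differential at `0` of the `𝔭`-orbit map of `v` is `ℂ`-linear (the `L²` shadow of
`IsHolGerm`: «`𝔭⁻ v = 0`»). (print: Borel1997, §5.14) (print: BorelWallach2000, VII 2.10) -/
def IsWeaklyHol (v : 𝒢.L2 μ) : Prop :=
  ∀ b : Fin 2 → ℂ,
    fderiv ℝ (orbitP 𝒢 μ ιinf v) 0 (Complex.I • b) = Complex.I • fderiv ℝ (orbitP 𝒢 μ ιinf v) 0 b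

/-- **`Realises 𝒢 μ ιinf Ψ w` — `Ψ` is a REGULAR REPRESENTATIVE of the `L²` class `w`**: `Ψ : G(𝔸) → ℂ` is left-invariant under
`A_G · G(K)` (so it is a function on the automorphic quotient, ★ `toQuotFun_mk`), continuous, its class is `w`, it is differentiable
along the `𝔭`-probes at every base point with probe derivatives continuous in the base point, and these probe derivatives REPRESENT the
`L²`-derivatives of the `𝔭`-orbit map of `w`. (print: Borel1997, Thm. 2.13 and §8.4) (print: HarishChandra1968, §I.2) -/
structure Realises (Ψ : 𝒢.Adelic → ℂ) (w : 𝒢.L2 μ) : Prop where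
  leftInv : ∀ γ ∈ 𝒢.quotientSubgroup, ∀ x, Ψ (γ * x) = Ψ x
  cont : Continuous Ψ
  aeEq : toQuotFun 𝒢 Ψ =ᵐ[μ] (w : 𝒢.automorphicQuotient → ℂ)
  diff : ∀ y, DifferentiableAt ℝ (probeP 𝒢 ιinf Ψ y) 0
  contDeriv : ∀ b : Fin 2 → ℂ, Continuous fun y => fderiv ℝ (probeP 𝒢 ιinf Ψ y) 0 b
  derivAe : ∀ b : Fin 2 → ℂ,
    toQuotFun 𝒢 (fun y => fderiv ℝ (probeP 𝒢 ιinf Ψ y) 0 b) =ᵐ[μ]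
      ((fderiv ℝ (orbitP 𝒢 μ ιinf w) 0 b : 𝒢.L2 μ) : 𝒢.automorphicQuotient → ℂ)

/-- **`IsRegularKernel A` — a continuous, compactly supported `2 × 2`-matrix kernel on `U(2,1)` that is `C¹` ALONG THE LEFT
`𝔭`-PROBES with jointly continuous probe derivative**: `b ↦ A(exp X_b · u′)` is `C¹` on `ℂ²` for every `u′`, and
`(b, u′) ↦ ∂_b A(exp X_b · u′)` is continuous (what differentiating `∫ A((exp X_b)⁻¹ u′) w̃(y · ιinf u′) dν(u′)` under the integral sign
needs, and no more; an explicit real-analytic kernel has it). (print: Borel1997, §2.13) (print: HarishChandra1966, §8) -/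
structure IsRegularKernel (A : U21 → Matrix (Fin 2) (Fin 2) ℂ) : Prop where
  cont : Continuous A
  supp : HasCompactSupport A
  diff : ∀ (j i : Fin 2) (u' : U21), ContDiff ℝ 1 fun b : Fin 2 → ℂ => A (BallForms.expP b * u') j i
  contDeriv : ∀ j i : Fin 2,
    Continuous fun p : (Fin 2 → ℂ) × U21 => fderiv ℝ (fun b : Fin 2 → ℂ => A (BallForms.expP b * p.2) j i) p.1

/-- **`IsReproducedAlong ιinf ν A`** — the matrix kernel `A` REPRODUCES every `ℂ²`-valued function on `G` of right cotangent
`K_∞`-type `τ = weightOf x₀` along `ιinf ∘ Stab(x₀)` with holomorphic germs along `ιinf`: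
`∫_{U(2,1)} A(u) · Φ(y · ιinf u) dν(u) = Φ(y)` for every `y ∈ G` (the MEAN-VALUE PROPERTY of holomorphic functions on the ball `𝔹² = U(2,1)/K`,
transported by the cotangent automorphy factor). (print: Borel1997, §2.13–2.14 and §5.14) (print: HarishChandra1966, §8, Thm. 1) -/
def IsReproducedAlong {G : Type} [Group G] (ιG : U21 →* G) (ν : Measure U21) (A : U21 → Matrix (Fin 2) (Fin 2) ℂ) : Prop :=
  ∀ Φ : G → (Fin 2 → ℂ),
    (∀ (k : stabilizer (↥U21) x₀) (g : G),
        Φ (g * ιG k) = BallForms.isPullbackCocycle_cotangentCocycle.weightOf x₀ k⁻¹ (Φ g)) →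
    IsHolGerm ιG Φ →
      ∀ y : G, ∫ u, A u *ᵥ Φ (y * ιG u) ∂ν = Φ y

end Generic

section Engine

variable (L : Type) [Field L] [NumberField L] [IsCMField L]

/-- The engine datum `U(H)` over `L⁺` (★ `UnitaryGroup.adelicGroupData` at `(L⁺, L, c̄, 3, H)`), abbreviated. (print: BorelJacquet1979, §4.1) -/
abbrev G3 (H : Matrix (Fin 3) (Fin 3) L) : AdelicGroupData.{0} (↥(maximalRealSubfield L)) :=
  adelicGroupData (↥(maximalRealSubfield L)) L (IsCMField.complexConj L) 3 H

variable (ι : L →+* ℂ) (H : Matrix (Fin 3) (Fin 3) L) (T : GL (Fin 3) ℂ)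
  (hT : (T : Matrix (Fin 3) (Fin 3) ℂ)ᴴ * H.map ι * (T : Matrix (Fin 3) (Fin 3) ℂ) = Literature.Geometry.ComplexHyperbolic.BallModel.J)
  (μ : Measure (G3 L H).automorphicQuotient) [(G3 L H).IsAutomorphicMeasure μ]

/-- **`IsL2CotPair … ν A u` — the `L²`-LEVEL COTANGENT DATA of a pair of classes `u = (u_0, u_1)`** (what `pr_P` can see of a
holomorphic cotangent form): REPRODUCTION `T_A u = u` by the kernel `A` (`kernelOp`), right `K_c`-invariance (`cmCompactFactor`), right
invariance under an OPEN `K_f ≤ U(H)(𝔸_{L⁺,f})`, the cotangent `K_∞`-TYPE RELATION `R(ιinf k) u_j = Σ_i (τ k⁻¹ e_i)_j • u_i` for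
`k ∈ Stab_{U(2,1)}(x₀)`, `τ = weightOf x₀` of the cotangent cocycle (the `L²` reading of `Φ (x · ιinf k) = τ k⁻¹ (Φ x)`, ★ `weightForms`),
differentiability at `0` of the `𝔭`-orbit map of each coordinate, and weak Cauchy–Riemann. (print: BorelJacquet1979, §4.2 and §4.6)
(print: Borel1997, §2.13 and §5.14) -/
structure IsL2CotPair (ν : Measure U21) (A : U21 → Matrix (Fin 2) (Fin 2) ℂ) (u : Fin 2 → (G3 L H).L2 μ) : Prop where
  repro : ∀ j, kernelOp (G3 L H) μ (cmArchSection L ι H T hT) ν A u j = u j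
  kc : ∀ k ∈ cmCompactFactor L ι H T hT, ∀ j, (G3 L H).rightRegular μ k (u j) = u j
  kf : ∃ Kf : Subgroup (finAdelic (↥(maximalRealSubfield L)) L (IsCMField.complexConj L) 3 H),
    IsOpen (Kf : Set (finAdelic (↥(maximalRealSubfield L)) L (IsCMField.complexConj L) 3 H)) ∧
      ∀ k ∈ Kf, ∀ j, (G3 L H).rightRegular μ (finAdelicToAdelic (↥(maximalRealSubfield L)) L (IsCMField.complexConj L) 3 H k) (u j) = u j
  ktype : ∀ (k : stabilizer (↥U21) x₀) (j : Fin 2),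
    (G3 L H).rightRegular μ (cmArchSection L ι H T hT k) (u j) =
      ∑ i : Fin 2, (BallForms.isPullbackCocycle_cotangentCocycle.weightOf x₀ k⁻¹ (Pi.single i 1)) j • u i
  diffOrbit : ∀ j, DifferentiableAt ℝ (orbitP (G3 L H) μ (cmArchSection L ι H T hT) (u j)) 0
  weakHol : ∀ j, IsWeaklyHol (G3 L H) μ (cmArchSection L ι H T hT) (u j)

end Engine

/-! ## §1 The six registered stubs -/

/-- **(K) A REPRODUCING KERNEL FOR HOLOMORPHIC COTANGENT-WEIGHT FUNCTIONS ON `U(2,1)` — the load-bearing analytic stub.**  For every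
Haar measure `ν` on `U(2,1)` there is a continuous, compactly supported `2 × 2`-matrix kernel `A`, `C¹` along the left `𝔭`-probes
(`IsRegularKernel`), such that for every group `G`, every `ιG : U(2,1) →* G` and every `Φ : G → ℂ²` of right cotangent `K_∞`-type
`τ = weightOf x₀` along `ιG ∘ Stab(x₀)` with holomorphic germs along `ιG` (`IsHolGerm`), `∫ A(u) · Φ(y · ιG u) dν(u) = Φ(y)` for ALL
`y` (`IsReproducedAlong`).  WHY (MEMO `F0/P2/CENSUS-R.F0P2p01g2.md` §3 road (h), h1): by the weight clause `u ↦ Φ(y · ιG u)` is the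
group function `(Jac(u, x₀))ᵀ · F_y(u · x₀)` of a well-defined `F_y : 𝔹² → ℂ²`, HOLOMORPHIC on the ball by ★
`BallForms.mem_holomorphic_of_differentiableAt_expP` (its hypothesis is exactly `IsHolGerm` at the base points `y · ιG u`); take
`A(u) := β(‖u · x₀‖²) • ((Jac(u, x₀))ᵀ)⁻¹` with `β` a radial bump supported in `[0, r²)`, `r < 1`, normalised against the orbit push-forward
`(u ↦ u · x₀)_* ν = c · dβ_Bergman` (★ `map_orbit_haar_eq_smul_bergmanVolume`): then `∫ A(u) Φ(y ιG u) dν = c ∫_{𝔹²} β(‖z‖²) F_y(z) dβ(z)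
= F_y(0) · (c ∫ β ρ) = Φ(y)` by the MEAN-VALUE PROPERTY of holomorphic functions for radial measures (two nested one-variable
`circleAverage`s, Mathlib `Analysis/Complex/MeanValue`, + Fubini; no Hartogs).  A bi-`K`-invariant SCALAR kernel would kill every non-trivial
`K`-type — the MATRIX factor `(Jacᵀ)⁻¹` is essential (ref1's falsifier).  Size M–L; pure `U(2,1)`/ball analysis, no adeles.
(print: Borel1997, §2.13–2.14 and §5.14) (print: HarishChandra1966, §8, Thm. 1) (print: Helgason2000, Ch. I §1, Thm. 1.9) -/
def StubKReproducingKernel : Prop :=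
  ∀ (ν : Measure U21) [ν.IsHaarMeasure],
    ∃ A : U21 → Matrix (Fin 2) (Fin 2) ℂ,
      IsRegularKernel A ∧ ∀ (G : Type) [Group G] (ιG : U21 →* G), IsReproducedAlong ιG ν A

/-- **(S) The `L²` classes of a holomorphic cotangent form carry the `L²`-level cotangent data.**  In the engine setting (`L` CM,
`[L⁺:ℚ] ≥ 2`, `H` of signature `(2,1)` at `ι` with frame `T`, positive definite elsewhere — so the automorphic quotient is compact, ★
`compactSpace_automorphicQuotient_adelicDatum` — `μ` automorphic), given a regular kernel `A` reproducing along `cmArchSection`: for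
`Φ ∈ holCotForms` with square-integrable coordinates the pair `u_j := [Φ·j]` satisfies `IsL2CotPair ν A u`.  WHY: `repro` is the `L²` image
of the pointwise identity `∫ A(u) Φ(y · ιinf u) dν = Φ(y)` (weight clause and `IsHolGerm` from ★ `mem_holCotForms_iff`) under the FUBINI
REPRESENTATIVE of `∫ A(u)_{ji} • R(ιinf u)[Φ·i] dν` (★ `coeFn_integral_rightRegular_toLp`, generalised from curves `ℝ → G(𝔸)` to the
parameter space `(U(2,1), ν|supp A)` — same proof); `kc` ∕ `kf` ∕ `ktype` are the `L²` images of the pointwise clauses under the dictionary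
`R a [Φ] = [Φ(· a)]` (★ `rightRegular_apply_coeFn`, `toQuotFun_mk`; `kf` from `smoothFun` = a finite sum of vectors fixed by open
subgroups is fixed by their open intersection); `diffOrbit` and `weakHol`: the `𝔭`-orbit map `b ↦ R(ιinf exp X_b)[Φ·j]` is the class of
`y ↦ Φ(y · ιinf exp X_b)·j`, whose probe derivatives exist (`IsHolGerm`), are continuous on `G(𝔸)` (along `U(2,1)`-orbits from
reproduction ∕ holomorphy, across by `K_c K_f`-invariance and the product structure `G(𝔸) ⊇ ιinf(U(2,1)) · K_c · K_f` open) hence bounded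
on the compact quotient, so the `L²` difference quotients converge by dominated convergence to the class of the pointwise derivative, which
is `ℂ`-linear in `b` by `IsHolGerm`.  Size M. (print: Borel1997, §2.13 and §5.14) (print: BorelJacquet1979, §4.2) -/
def StubSCotFormL2Data : Prop :=
  ∀ (L : Type) [Field L] [NumberField L] [IsCMField L] (ι : L →+* ℂ) (H : Matrix (Fin 3) (Fin 3) L) (T : GL (Fin 3) ℂ)
    (hT : (T : Matrix (Fin 3) (Fin 3) ℂ)ᴴ * H.map ι * (T : Matrix (Fin 3) (Fin 3) ℂ) = Literature.Geometry.ComplexHyperbolic.BallModel.J),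
    (∀ τ' : L →+* ℂ, InfinitePlace.mk τ' ≠ InfinitePlace.mk ι → (H.map τ').PosDef) →
    2 ≤ Module.finrank ℚ ↥(maximalRealSubfield L) →
    ∀ (μ : Measure (G3 L H).automorphicQuotient) [(G3 L H).IsAutomorphicMeasure μ]
      (ν : Measure U21) [ν.IsHaarMeasure] (A : U21 → Matrix (Fin 2) (Fin 2) ℂ),
      IsRegularKernel A → IsReproducedAlong (cmArchSection L ι H T hT) ν A →
    ∀ (Φ : (G3 L H).Adelic → (Fin 2 → ℂ)),
      Φ ∈ holCotForms (↥(maximalRealSubfield L)) L (IsCMField.complexConj L) 3 H (cmArchSection L ι H T hT)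
          (cmCompactFactor L ι H T hT) →
    ∀ hΦ : ∀ j : Fin 2, MemLp (toQuotFun (G3 L H) fun g => Φ g j) 2 μ,
      IsL2CotPair L ι H T hT μ ν A fun j => MemLp.toLp (toQuotFun (G3 L H) fun g => Φ g j) (hΦ j)

/-- **(H) `pr_P` transports the `L²`-level cotangent data.**  For every discrete automorphic `P` and every pair `u` with
`IsL2CotPair ν A u`, the projected pair `j ↦ pr_P u_j` (`P.space.toSubmodule.starProjection`) again satisfies `IsL2CotPair ν A`: `pr_P` is
continuous linear and commutes with `R(g)` for every `g ∈ U(H)(𝔸_{L⁺})` (★ `DiscreteAutomorphicRep.starProjection_rightRegular`,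
`rightRegular_starProjection_eq_sum`, `rightRegular_starProjection_of_forall`), so `repro` passes through the Bochner integral
(Mathlib `ContinuousLinearMap.integral_comp_comm`: `pr_P ∘ T_A = T_A ∘ pr_P`), invariances and the type relation pass through, the
`𝔭`-orbit map of `pr_P v` is `pr_P ∘ (orbit map of v)` (differentiable, chain rule) and its differential is `pr_P ∘ D` (`ℂ`-linear with
`D`).  Size S–M (glue). (print: BorelJacquet1979, §4.6) (print: DeitmarEchterhoff2014, Thm. 7.3.2) -/
def StubHProjectedL2Data : Prop :=
  ∀ (L : Type) [Field L] [NumberField L] [IsCMField L] (ι : L →+* ℂ) (H : Matrix (Fin 3) (Fin 3) L) (T : GL (Fin 3) ℂ)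
    (hT : (T : Matrix (Fin 3) (Fin 3) ℂ)ᴴ * H.map ι * (T : Matrix (Fin 3) (Fin 3) ℂ) = Literature.Geometry.ComplexHyperbolic.BallModel.J)
    (μ : Measure (G3 L H).automorphicQuotient) [(G3 L H).IsAutomorphicMeasure μ]
    (ν : Measure U21) [ν.IsHaarMeasure] (A : U21 → Matrix (Fin 2) (Fin 2) ℂ)
    (P : DiscreteAutomorphicRep (G3 L H) μ) (u : Fin 2 → (G3 L H).L2 μ),
      IsL2CotPair L ι H T hT μ ν A u → IsL2CotPair L ι H T hT μ ν A fun j => P.space.toSubmodule.starProjection (u j)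

/-- **(R) REGULARITY OF REPRODUCED CLASSES — a `K_c K_f`-invariant pair of `L²` classes on the compact quotient that is reproduced by a
regular kernel, `w = T_A w`, has CONTINUOUS representatives, `C¹` along the `𝔭`-probes, whose probe derivatives are continuous and
represent the `L²`-derivatives** (`Realises`).  WHY (CENSUS-R §3 road (h), h3 + h4): choose an everywhere right-`K_c K_f`-invariant
version `w̄_i` of `invQuot (w i)` (average over the compact group `K_c K_f`; ★ `invQuot`, `invQuot_mul_left`) and put
`Ψ_j(y) := Σ_i ∫ A(u)_{ji} w̄_i(y · ιinf u) dν(u)`.  (1) Its class is `T_A w = w` (Fubini representative, as in (S)).  (2) It is defined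
EVERYWHERE: the set of `y` where `u ↦ w̄(y · ιinf u)` is locally `ν`-integrable is conull (Fubini), left-`U(H)(L⁺)`-invariant and
right-invariant under the OPEN subgroup `U′ = ιinf(U(2,1)) · K_c · K_f` (`G_∞ = ιinf(U(2,1)) × K_c`; product structure from ★ `cmArchSection`,
`cmCompactFactor`, `finAdelicToAdelic`), so its complement is a null union of sets each projecting onto an OPEN subset of the quotient, hence
empty (`μ` charges opens, ★ `IsAutomorphicMeasure`).  (3) Along `U(2,1)`-orbits `u₀ ↦ Ψ(y · ιinf u₀) = ∫ A(u₀⁻¹ u′) w̄(y · ιinf u′) dν(u′)`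
(left invariance of `ν`) is continuous, and `C¹` along `b ↦ exp X_b` with derivative `∫ ∂_b[A((exp X_b)⁻¹ u′)] w̄(y ιinf u′) dν(u′)` by
differentiation under the integral sign (Mathlib `hasFDerivAt_integral_of_dominated_of_fderiv_le`; domination from `IsRegularKernel`);
continuity ACROSS orbits from `K_c K_f`-invariance and the product structure (h4); the probe derivatives are again of the form
«regular kernel applied to `w̄`», hence continuous, left-invariant, bounded on the compact quotient, so the `L²` difference quotients of the
`𝔭`-orbit map converge to their class (dominated convergence; ★ `expP_add_smul` for the probe semigroup law).  Size M–L (measure ∕ topology,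
no Sobolev, no `(𝔤,K)`-theory); reusable verbatim by the (E)-desk and P3. (print: Borel1997, Thm. 2.13 and §8.4) (print: HarishChandra1966, §8)
(print: BorelJacquet1979, §4.1–4.2) -/
def StubRRegularOfReproduced : Prop :=
  ∀ (L : Type) [Field L] [NumberField L] [IsCMField L] (ι : L →+* ℂ) (H : Matrix (Fin 3) (Fin 3) L) (T : GL (Fin 3) ℂ)
    (hT : (T : Matrix (Fin 3) (Fin 3) ℂ)ᴴ * H.map ι * (T : Matrix (Fin 3) (Fin 3) ℂ) = Literature.Geometry.ComplexHyperbolic.BallModel.J),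
    (∀ τ' : L →+* ℂ, InfinitePlace.mk τ' ≠ InfinitePlace.mk ι → (H.map τ').PosDef) →
    2 ≤ Module.finrank ℚ ↥(maximalRealSubfield L) →
    ∀ (μ : Measure (G3 L H).automorphicQuotient) [(G3 L H).IsAutomorphicMeasure μ]
      (ν : Measure U21) [ν.IsHaarMeasure] (A : U21 → Matrix (Fin 2) (Fin 2) ℂ), IsRegularKernel A →
    ∀ (w : Fin 2 → (G3 L H).L2 μ),
      (∀ j, kernelOp (G3 L H) μ (cmArchSection L ι H T hT) ν A w j = w j) →
      (∀ k ∈ cmCompactFactor L ι H T hT, ∀ j, (G3 L H).rightRegular μ k (w j) = w j) →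
      (∃ Kf : Subgroup (finAdelic (↥(maximalRealSubfield L)) L (IsCMField.complexConj L) 3 H),
        IsOpen (Kf : Set (finAdelic (↥(maximalRealSubfield L)) L (IsCMField.complexConj L) 3 H)) ∧
          ∀ k ∈ Kf, ∀ j,
            (G3 L H).rightRegular μ (finAdelicToAdelic (↥(maximalRealSubfield L)) L (IsCMField.complexConj L) 3 H k) (w j) = w j) →
        ∃ Ψ : Fin 2 → ((G3 L H).Adelic → ℂ), ∀ j, Realises (G3 L H) μ (cmArchSection L ι H T hT) (Ψ j) (w j)

/-- **(G) Pointwise Cauchy–Riemann from the weak one.**  If `Ψ_j` `Realises` `w_j` (`j = 0, 1`) and each `w_j` is weakly holomorphic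
(`IsWeaklyHol`: `ℂ`-linear `L²`-differential of the `𝔭`-orbit map), then the `ℂ²`-valued function `x ↦ (Ψ_0 x, Ψ_1 x)` has HOLOMORPHIC
GERMS along `cmArchSection` (★ `CotangentForms.IsHolGerm`).  WHY: differentiability of the germs is `Realises.diff` coordinatewise
(`differentiableAt_pi`); the Cauchy–Riemann defect `y ↦ ∂Ψ_j(y)(I b) − I ∂Ψ_j(y)(b)` is continuous (`Realises.contDeriv`), left-invariant,
and its class on the quotient is `D_j(I b) − I D_j(b) = 0` (`Realises.derivAe`, `IsWeaklyHol`, `Lp.coeFn_smul`), so it vanishes a.e., hence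
everywhere because `μ` charges every non-empty open set (★ `IsAutomorphicMeasure` ⊇ `IsOpenPosMeasure`; Mathlib `Continuous.ae_eq_iff_eq`)
and `toQuotFun` of a continuous left-invariant function is continuous (★ `toQuotFun_mk`, quotient map open).  Size M.
(print: Borel1997, §5.14) (print: BorelWallach2000, VII 2.10) -/
def StubGHolGermOfWeak : Prop :=
  ∀ (L : Type) [Field L] [NumberField L] [IsCMField L] (ι : L →+* ℂ) (H : Matrix (Fin 3) (Fin 3) L) (T : GL (Fin 3) ℂ)
    (hT : (T : Matrix (Fin 3) (Fin 3) ℂ)ᴴ * H.map ι * (T : Matrix (Fin 3) (Fin 3) ℂ) = Literature.Geometry.ComplexHyperbolic.BallModel.J)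
    (μ : Measure (G3 L H).automorphicQuotient) [(G3 L H).IsAutomorphicMeasure μ]
    (w : Fin 2 → (G3 L H).L2 μ) (Ψ : Fin 2 → ((G3 L H).Adelic → ℂ)),
      (∀ j, Realises (G3 L H) μ (cmArchSection L ι H T hT) (Ψ j) (w j)) →
      (∀ j, IsWeaklyHol (G3 L H) μ (cmArchSection L ι H T hT) (w j)) →
        IsHolGerm (cmArchSection L ι H T hT) (fun x j => Ψ j x)

/-- **(T) Pointwise invariances from the a.e. ones: the regular representative is a holomorphic cotangent form.**  If `Ψ_j` `Realises`
`w_j`, the pair `w` carries the `L²`-level K_c ∕ K_f ∕ `τ`-type relations, and `x ↦ (Ψ_0 x, Ψ_1 x)` has holomorphic germs along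
`cmArchSection`, then `x ↦ (Ψ_0 x, Ψ_1 x) ∈ holCotForms` (★ `mem_holCotForms_iff`: left `U(H)(L⁺)`-invariance from `Realises.leftInv` and ★
`arithmeticSubgroup_le_quotientSubgroup`; the right `K_∞`-type identity `Ψ(x · ιinf k) = τ k⁻¹ (Ψ x)`, the right `K_c`-invariance and the
right invariance under the open `K_f` (hence `Ψ ∈ smoothFun`, one open subgroup suffices) are identities between CONTINUOUS left-invariant
functions that hold a.e. on the quotient by the `L²` relations and the dictionary `R a [Ψ] = [Ψ(· a)]` (★ `rightRegular_apply_coeFn`,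
`toQuotFun_mk`, `SMulInvariantMeasure` for composing a.e. equalities with `x ↦ a⁻¹ • x`), hence everywhere since `μ` charges opens).  Size M−.
(print: BorelJacquet1979, §4.2) (print: Borel1997, §5.14) -/
def StubTMemHolCotFormsOfAe : Prop :=
  ∀ (L : Type) [Field L] [NumberField L] [IsCMField L] (ι : L →+* ℂ) (H : Matrix (Fin 3) (Fin 3) L) (T : GL (Fin 3) ℂ)
    (hT : (T : Matrix (Fin 3) (Fin 3) ℂ)ᴴ * H.map ι * (T : Matrix (Fin 3) (Fin 3) ℂ) = Literature.Geometry.ComplexHyperbolic.BallModel.J)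
    (μ : Measure (G3 L H).automorphicQuotient) [(G3 L H).IsAutomorphicMeasure μ]
    (w : Fin 2 → (G3 L H).L2 μ) (Ψ : Fin 2 → ((G3 L H).Adelic → ℂ)),
      (∀ j, Realises (G3 L H) μ (cmArchSection L ι H T hT) (Ψ j) (w j)) →
      (∀ k ∈ cmCompactFactor L ι H T hT, ∀ j, (G3 L H).rightRegular μ k (w j) = w j) →
      (∃ Kf : Subgroup (finAdelic (↥(maximalRealSubfield L)) L (IsCMField.complexConj L) 3 H),
        IsOpen (Kf : Set (finAdelic (↥(maximalRealSubfield L)) L (IsCMField.complexConj L) 3 H)) ∧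
          ∀ k ∈ Kf, ∀ j,
            (G3 L H).rightRegular μ (finAdelicToAdelic (↥(maximalRealSubfield L)) L (IsCMField.complexConj L) 3 H k) (w j) = w j) →
      (∀ (k : stabilizer (↥U21) x₀) (j : Fin 2),
        (G3 L H).rightRegular μ (cmArchSection L ι H T hT k) (w j) =
          ∑ i : Fin 2, (BallForms.isPullbackCocycle_cotangentCocycle.weightOf x₀ k⁻¹ (Pi.single i 1)) j • w i) →
      IsHolGerm (cmArchSection L ι H T hT) (fun x j => Ψ j x) →
        (fun x j => Ψ j x) ∈ holCotForms (↥(maximalRealSubfield L)) L (IsCMField.complexConj L) 3 H (cmArchSection L ι H T hT)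
          (cmCompactFactor L ι H T hT)

/-- (K) registered stub — the reproducing kernel (hardest, load-bearing). [cite: Borel1997, §2.13–2.14] [cite: HarishChandra1966, §8, Thm. 1]
v1.3: CLOSED BY NAME by ★ p797711 `Literature/NumberTheory/Automorphic/UnitaryGroupHolCotFormsReproducing.lean :: UnitaryGroup.CotangentForms.stubK_reproducingKernel_holds` (p03 (g2); over ★ p797219 ∕ ★ p797517) — statement unchanged. -/
theorem stub_K_reproducingKernel : StubKReproducingKernel := fun ν _ =>
  (Literature.NumberTheory.Automorphic.UnitaryGroup.CotangentForms.stubK_reproducingKernel_holds ν).imp fun _ h =>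
    ⟨⟨h.1.1, h.1.2.1, h.1.2.2.1, h.1.2.2.2⟩, h.2⟩

/-- (S) registered stub. [cite: Borel1997, §5.14]
v1.5: CLOSED BY NAME by ★ p798875 `Theorems/F0P2dStubSCotFormL2Data.lean :: F0P2dStubSCotFormL2Data.stubSCotFormL2Data_holds` (A-p18 (g16); the fold term is
A-p18's 00:51:12Z word verbatim, cert `A-provers/A-p18/g16/F0P2d/CERT-S-fold.A-p18g16.lean`) — statement unchanged. -/
theorem stub_S_cotFormL2Data : StubSCotFormL2Data := fun L _ _ _ ι H T hT hdef hrk μ _ ν _ A hA hrep Φ hΦ h2 =>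
  let h := Summit.HodgeConjecture.HodgeConjecture.Cruxes.H413.F0P2dStubSCotFormL2Data.stubSCotFormL2Data_holds
    L ι H T hT hdef hrk μ ν A hA.cont hA.supp hA.diff hA.contDeriv hrep Φ hΦ h2
  ⟨h.1, h.2.1, h.2.2.1, h.2.2.2.1, h.2.2.2.2.1, h.2.2.2.2.2⟩

/-- (H) registered stub. [cite: BorelJacquet1979, §4.6]
v1.2: CLOSED BY NAME by ★ p797557 `Theorems/F0P2dStubHProjectedL2Data.lean :: stubHProjectedL2Data_holds` (A-p06 (g18)) — statement unchanged. -/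
theorem stub_H_projectedL2Data : StubHProjectedL2Data := fun L _ _ _ ι H T hT μ _ ν _ A P u hu =>
  let h := Summit.HodgeConjecture.HodgeConjecture.Cruxes.H413.F0P2dStubHProjectedL2Data.stubHProjectedL2Data_holds
    L ι H T hT μ ν A P u hu.repro hu.kc hu.kf hu.ktype hu.diffOrbit hu.weakHol
  ⟨h.1, h.2.1, h.2.2.1, h.2.2.2.1, h.2.2.2.2.1, h.2.2.2.2.2⟩

/-- (R) registered stub — regularity of reproduced classes. [cite: Borel1997, Thm. 2.13 and §8.4]
v1.4: CLOSED BY NAME by ★ p798945 `Theorems/F0P2dStubR.lean :: F0P2dStubR.stubR_holds` (F0P2-p04 (g2); the fold term is p04's 00:49:48Z word verbatim,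
by-paste certificate `F0/P2/CERT-R-fold.bypaste.F0P2p04g2.lean`) — statement unchanged. -/
theorem stub_R_regularOfReproduced : StubRRegularOfReproduced := fun L _ _ _ ι H T hT hdef hrk μ _ ν _ A hA w hrep hkc hkf => by
  obtain ⟨Ψ, h⟩ := F0P2dStubR.stubR_holds L ι H T hT hdef hrk μ ν A hA.cont hA.supp hA.diff hA.contDeriv w hrep hkc hkf
  exact ⟨Ψ, fun j => ⟨(h j).1, (h j).2.1, (h j).2.2.1, (h j).2.2.2.1, (h j).2.2.2.2.1, (h j).2.2.2.2.2⟩⟩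

/-- (G) registered stub. [cite: Borel1997, §5.14]
v1.2: CLOSED BY NAME by ★ p797242 `Theorems/P2StubGHolGermOfWeak.lean` (F0P2-p01 (g2); F0P2-ref1 r29 countersign) — statement unchanged. -/
theorem stub_G_holGermOfWeak : StubGHolGermOfWeak := fun L _ _ _ ι H T hT μ _ w Ψ hR hW =>
  Summit.HodgeConjecture.HodgeConjecture.Cruxes.H413.P2StubGHolGermOfWeak.isHolGerm_of_weaklyHol (G3 L H) μ
    (cmArchSection L ι H T hT) w Ψ (fun j => (hR j).leftInv) (fun j => (hR j).diff) (fun j => (hR j).contDeriv)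
    (fun j => (hR j).derivAe) hW

/-- (T) registered stub. [cite: BorelJacquet1979, §4.2]
v1.2: CLOSED BY NAME by ★ p797536 `Theorems/F0P2dStubT.lean :: stubT_holds` (F0P2-p02 (g2)) — statement unchanged. -/
theorem stub_T_memHolCotFormsOfAe : StubTMemHolCotFormsOfAe := fun L _ _ _ ι H T hT μ _ w Ψ hΨ =>
  Summit.HodgeConjecture.HodgeConjecture.Cruxes.H413.F0P2dStubT.stubT_holds L ι H T hT μ w Ψ fun j =>
    ⟨(hΨ j).leftInv, (hΨ j).cont, (hΨ j).aeEq, (hΨ j).diff, (hΨ j).contDeriv, (hΨ j).derivAe⟩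

/-! ## §2 Heads (sorry-free): the (D) socket BY NAME, and (D̄) by ★ p794879 -/

/-- **HEAD — (D) from the six stubs, concluding ★ `CotangentForms.holCotFormSpectralProjection` BY NAME.**  Plumbing only: a Haar
measure `ν` on `U(2,1)` (Mathlib `Measure.haar`) and the kernel `A` of (K); `u := [Φ]` (S) ↦ `w := pr_P ∘ u` (H) ↦ regular representatives
`Ψ` of the reproduced pair `w = T_A w` (R) ↦ holomorphic germs (G) ↦ `Ψ ∈ holCotForms` (T); the classes agree by `Realises.aeEq`.
[cite: BorelJacquet1979, §4.6] [cite: Borel1997, Thm. 2.13] -/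
theorem holCotFormSpectralProjection_of (sK : StubKReproducingKernel) (sS : StubSCotFormL2Data)
    (sH : StubHProjectedL2Data) (sR : StubRRegularOfReproduced) (sG : StubGHolGermOfWeak)
    (sT : StubTMemHolCotFormsOfAe) : holCotFormSpectralProjection := by
  intro L _ _ _ ι H T hT hdef hrk μ _ P Φ hΦmem hΦ
  obtain ⟨A, hA, hrep⟩ := sK (Measure.haar (G := U21))
  have hu : IsL2CotPair L ι H T hT μ Measure.haar A
      (fun j => MemLp.toLp (toQuotFun (G3 L H) fun g => Φ g j) (hΦ j)) :=
    sS L ι H T hT hdef hrk μ Measure.haar A hA (hrep _ (cmArchSection L ι H T hT)) Φ hΦmem hΦ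
  have hw := sH L ι H T hT μ Measure.haar A P _ hu
  obtain ⟨Ψ, hΨ⟩ := sR L ι H T hT hdef hrk μ Measure.haar A hA _ hw.repro hw.kc hw.kf
  have hgerm := sG L ι H T hT μ _ Ψ hΨ hw.weakHol
  have hmem := sT L ι H T hT μ _ Ψ hΨ hw.kc hw.kf hw.ktype hgerm
  have hmemLp : ∀ j : Fin 2, MemLp (toQuotFun (G3 L H) fun g => Ψ j g) 2 μ := fun j =>
    (Lp.memLp _).ae_eq (hΨ j).aeEq.symm
  refine ⟨fun x j => Ψ j x, hmem, hmemLp, fun j => ?_⟩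
  refine (Lp.ext ?_).symm
  exact (MemLp.coeFn_toLp (hmemLp j)).trans (hΨ j).aeEq

/-- Alias under the registered-fold name. [cite: BorelJacquet1979, §4.6] -/
theorem holCotFormSpectralProjection_of_stubs (sK : StubKReproducingKernel) (sS : StubSCotFormL2Data)
    (sH : StubHProjectedL2Data) (sR : StubRRegularOfReproduced) (sG : StubGHolGermOfWeak)
    (sT : StubTMemHolCotFormsOfAe) : holCotFormSpectralProjection :=
  holCotFormSpectralProjection_of sK sS sH sR sG sT

/-- **(D̄) from the same six stubs** via ★ `CotangentForms.antiholCotFormSpectralProjection_of_hol` (p794879: `P ↦ P̄` transports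
(D) to the antiholomorphic statement). [cite: BorelWallach2000, VII 2.10] -/
theorem antiholCotFormSpectralProjection_of_stubs (sK : StubKReproducingKernel) (sS : StubSCotFormL2Data)
    (sH : StubHProjectedL2Data) (sR : StubRRegularOfReproduced) (sG : StubGHolGermOfWeak)
    (sT : StubTMemHolCotFormsOfAe) : antiholCotFormSpectralProjection :=
  antiholCotFormSpectralProjection_of_hol (holCotFormSpectralProjection_of sK sS sH sR sG sT)

/-- **What the parent line's socket stub becomes** (the registrar's one-token fold, recorded as a kernel fact): the (D) ∕ (D̄) sockets
of `Lines/P2ThetaDictionaryExists.lean` ∕ `Lines/F0_P2CohSpectrumL2.lean` are implied by the six stubs of this sub-line.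
[cite: BorelJacquet1979, §4.6] -/
theorem socketD_of_stubs :
    StubKReproducingKernel → StubSCotFormL2Data → StubHProjectedL2Data → StubRRegularOfReproduced →
      StubGHolGermOfWeak → StubTMemHolCotFormsOfAe →
        holCotFormSpectralProjection ∧ antiholCotFormSpectralProjection :=
  fun sK sS sH sR sG sT =>
    ⟨holCotFormSpectralProjection_of sK sS sH sR sG sT, antiholCotFormSpectralProjection_of_stubs sK sS sH sR sG sT⟩

/-! ## §3 The crux `H413` BY NAME (what `ledger skeleton check` reads): the six stubs of this sub-line in place of the (D)∕(D̄)
sockets of ★ `P2H413OfSockets.H413_of_sockets` (p795208); the remaining hypotheses are the OTHER P2 sockets — (C)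
`Rogawski1990.cohFinComponent_isTheta`, (C′) `Def411WeilCarriers.rhoAtLine_lineClassTransport` (now dischargeable from (C) by the ★ P4 master
via `ThetaPinBridge.spectrumIsTheta_of_cohFinComponent_of_master`, F0P2-p02), U4 `StubU4SignRule` — and the two other floor rows `hJ3a` (P3), `hocc` (P4).
HC_CM is proved only modulo the printed citations until rung 0 closes. -/

/-- **The crux decl `HCCMUnconditional.H413` from this sub-line's six stubs and the other sockets ∕ floor rows.**
[cite: Liu2021, Prop. 4.13 and Rem. 4.14] [cite: Rogawski1990, Thm. 13.3.1] -/
theorem H413_proof (hC : Literature.NumberTheory.Rogawski1990.cohFinComponent_isTheta)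
    (hC' : Literature.NumberTheory.Automorphic.Liu2021.Def411WeilCarriers.rhoAtLine_lineClassTransport)
    (hU4 : SpectrumInterfaces.StubU4SignRule) (hJ3a : SpectrumInterfaces.HJ3aType) (hocc : SpectrumInterfaces.HoccType) :
    Summit.HodgeConjecture.HodgeConjecture.Theses.HCCMUnconditional.H413 :=
  P2H413OfSockets.H413_of_sockets hC hC'
    (holCotFormSpectralProjection_of_stubs stub_K_reproducingKernel stub_S_cotFormL2Data stub_H_projectedL2Data
      stub_R_regularOfReproduced stub_G_holGermOfWeak stub_T_memHolCotFormsOfAe)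
    (antiholCotFormSpectralProjection_of_stubs stub_K_reproducingKernel stub_S_cotFormL2Data stub_H_projectedL2Data
      stub_R_regularOfReproduced stub_G_holGermOfWeak stub_T_memHolCotFormsOfAe)
    hU4 hJ3a hocc

end Summit.HodgeConjecture.HodgeConjecture.Cruxes.H413.F0P2SpectralProjectionD

end
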